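import Mathlib.InformationTheory.Hamming
import Mathlib.LinearAlgebra.BilinearForm.Properties
import Mathlib.RingTheory.Trace.Basic
import Literature.InformationTheory.Coding.DualDistance
import HarnessLib

/-!
# Linear codes: the subfield image (binary image) of a code over an extension field

For a finite extension of fields `L/K` with a `K`-basis `B = (β_t)_{t ∈ κ}` of `L`, a word
`z ∈ L^ι` is *expanded* into the word `expand B z ∈ K^{ι × κ}` listing the `B`-coordinates of each
symbol, and an `L`-linear code `C ≤ L^ι` becomes the `K`-linear code
`subfieldImage B C ≤ K^{ι × κ}` (for `K = 𝔽₂`, `L = 𝔽_{2^m}`: the *binary image* of `C`). This is the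
step "a linear code over `𝔽_{64}` gives a binary linear code of six times the length" used, e.g.,
in Holmgren–Wein's Prop. 3 (binary codes with linear dual distance from algebraic-geometry codes over
`𝔽₆₄`, after Guruswami / Shpilka 2009 Thm. 4). We prove the two facts that make the step harmless
for distance AND dual distance:

* `minDist_le_minDist_subfieldImage`: the minimum distance does not decrease (a nonzero symbol has a
  nonzero coordinate; `hammingNorm_le_hammingNorm_expand`);
* `dualCode_subfieldImage_le`: **the dual of the image is contained in (in fact equals,
  `dualCode_subfieldImage`) the image of the dual code under the trace-dual basis**
  `B^∨ = B.traceDual` (Mathlib's `Module.Basis.traceDual`: `Tr(β^∨_s β_t) = δ_{st}`): if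
  `w ⊥ expand B (C)` then `w = expand B^∨ z` with `z ∈ C^⊥` — because
  `⟨expand B y, expand B^∨ z⟩ = Tr_{L/K} ⟨y, z⟩` (`expand_dotProduct_expand_traceDual`), `C` is
  `L`-linear, and the trace form of a separable extension is nondegenerate; hence
  `dualDist_le_dualDist_subfieldImage`: the dual distance does not decrease either.

Mathlib supplies the trace form `Algebra.traceForm`, its nondegeneracy `traceForm_nondegenerate`,
the trace-dual basis `Module.Basis.traceDual` (`Module.Basis.traceDual_repr_apply`) and
`LinearEquiv.funCongrLeft` (reindexing); the tree supplies `minDist`, `dualCode`, `dualDist`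
(`Literature/InformationTheory/Coding/DualDistance.lean`).

## References

* J. Holmgren, A. S. Wein, *Counterexamples to the low-degree conjecture*, ITCS 2021, Prop. 3
  (arXiv:2004.08454 p. 7: "a linear code `C` over `𝔽₂`" obtained from [Shpilka 2009, Thm. 4]) — held.
* C. T. Retter, *Orthogonality of binary codes derived from Reed–Solomon codes*, IEEE Trans.
  Inform. Theory 37 (1991), doi:10.1109/18.86992 (the Reed–Solomon case of the trace-dual-basis
  description of the dual of a binary image) — not held (paywalled), named for attribution only.
* Y. Wu, *On expanded cyclic codes*, arXiv:0805.0615, §II (expanded generator matrices "in terms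
  of trace and dual/complementary basis") — held.
-/

noncomputable section

namespace Literature.InformationTheory.Coding

open Matrix Finset
open scoped BigOperators

variable {K L : Type*} [Field K] [Field L] [Algebra K L]
variable {ι κ : Type*} [Fintype ι] [Fintype κ]

/-! ### Expanding symbols into coordinates -/

/-- **Expansion of a word over `L` into a word over the subfield `K`** with respect to a `K`-basis
`B` of `L`: position `(j, t)` holds the `t`-th `B`-coordinate of the `j`-th symbol. `K`-linear.
[folklore] -/
def expand (B : Module.Basis κ K L) : (ι → L) →ₗ[K] (ι × κ → K) :=
  LinearMap.pi fun p : ι × κ => (B.coord p.2) ∘ₗ (LinearMap.proj p.1 : (ι → L) →ₗ[K] L)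

omit [Fintype ι] [Fintype κ] in
/-- `expand B z (j, t)` is the `t`-th coordinate of `z j`. [folklore] -/
@[simp] theorem expand_apply (B : Module.Basis κ K L) (z : ι → L) (p : ι × κ) :
    expand B z p = B.repr (z p.1) p.2 := rfl

omit [Fintype ι] [Fintype κ] in
/-- Expansion is injective: a word is determined by the coordinates of its symbols. [folklore] -/
theorem expand_injective (B : Module.Basis κ K L) : Function.Injective (expand (ι := ι) B) := by
  intro y z h
  funext j
  apply B.repr.injective
  ext t
  exact congr_fun h (j, t)

omit [Fintype ι] in
/-- The inverse direction: the word with prescribed coordinates `w (j, ·)` in the basis `B`.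
[folklore] -/
def collect (B : Module.Basis κ K L) (w : ι × κ → K) : ι → L :=
  fun j => B.equivFun.symm fun t => w (j, t)

omit [Fintype ι] in
/-- `expand B (collect B w) = w`. [folklore] -/
@[simp] theorem expand_collect (B : Module.Basis κ K L) (w : ι × κ → K) : expand B (collect B w) = w := by
  funext ⟨j, t⟩
  simp only [expand_apply, collect]
  rw [← Module.Basis.equivFun_apply, LinearEquiv.apply_symm_apply]

omit [Fintype ι] in
/-- Expansion is surjective. [folklore] -/
theorem expand_surjective (B : Module.Basis κ K L) : Function.Surjective (expand (ι := ι) B) :=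
  fun w => ⟨collect B w, expand_collect B w⟩

omit [Fintype ι] in
/-- `collect B (expand B z) = z`. [folklore] -/
@[simp] theorem collect_expand (B : Module.Basis κ K L) (z : ι → L) : collect B (expand B z) = z :=
  expand_injective B (expand_collect B (expand B z))

omit [Fintype ι] in
/-- **Expansion as a `K`-linear equivalence** `L^ι ≃ K^{ι × κ}` (inverse `collect B`). [folklore] -/
def expandEquiv (B : Module.Basis κ K L) : (ι → L) ≃ₗ[K] (ι × κ → K) :=
  { expand B with
    invFun := collect B
    left_inv := collect_expand B
    right_inv := expand_collect B }

omit [Fintype ι] in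
/-- `expandEquiv B` is `expand B`. [folklore] -/
@[simp] theorem expandEquiv_apply (B : Module.Basis κ K L) (z : ι → L) :
    expandEquiv B z = expand B z := rfl

omit [Fintype ι] in
/-- The inverse of `expandEquiv B` is `collect B`. [folklore] -/
@[simp] theorem expandEquiv_symm_apply (B : Module.Basis κ K L) (w : ι × κ → K) :
    (expandEquiv B).symm w = collect B w := rfl

/-- **A nonzero symbol has a nonzero coordinate**: the Hamming weight does not decrease under
expansion, `‖z‖ ≤ ‖expand B z‖`. [folklore] -/
theorem hammingNorm_le_hammingNorm_expand [DecidableEq K] [DecidableEq L] (B : Module.Basis κ K L)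
    (z : ι → L) : hammingNorm z ≤ hammingNorm (expand B z) := by
  classical
  -- choose, for each nonzero symbol, a nonzero coordinate
  have hchoice : ∀ j : ι, z j ≠ 0 → ∃ t : κ, B.repr (z j) t ≠ 0 := by
    intro j hj
    by_contra h
    push Not at h
    exact hj (B.repr.map_eq_zero_iff.1 (Finsupp.ext h))
  haveI : Nonempty κ := B.index_nonempty
  choose! t ht using hchoice
  -- the map `j ↦ (j, t j)` injects the support of `z` into the support of `expand B z`
  unfold hammingNorm
  refine Finset.card_le_card_of_injOn (fun j => (j, t j)) (fun j hj => ?_) fun j _ j' _ h => ?_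
  · simp only [coe_filter, mem_univ, true_and, Set.mem_setOf_eq] at hj ⊢
    simpa using ht j hj
  · exact congr_arg Prod.fst h

/-! ### The subfield image of a code -/

/-- **The subfield image** (binary image when `K = 𝔽₂`) of an `L`-linear code `C ≤ L^ι` with
respect to the `K`-basis `B` of `L`: the `K`-linear code `{expand B c | c ∈ C} ≤ K^{ι × κ}` (the
construction by which, e.g., a linear code over `𝔽₆₄` is read as a binary linear code of six
times the length). [folklore] -/
def subfieldImage (B : Module.Basis κ K L) (C : Submodule L (ι → L)) : Submodule K (ι × κ → K) :=
  (C.restrictScalars K).map (expand B)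

omit [Fintype ι] [Fintype κ] in
/-- Membership in the subfield image. [folklore] -/
theorem mem_subfieldImage_iff (B : Module.Basis κ K L) (C : Submodule L (ι → L)) (w : ι × κ → K) :
    w ∈ subfieldImage B C ↔ ∃ z ∈ C, expand B z = w := by
  simp only [subfieldImage, Submodule.mem_map, Submodule.restrictScalars_mem]

omit [Fintype ι] [Fintype κ] in
/-- Codewords expand to codewords of the image. [folklore] -/
theorem expand_mem_subfieldImage (B : Module.Basis κ K L) {C : Submodule L (ι → L)} {z : ι → L}
    (hz : z ∈ C) : expand B z ∈ subfieldImage B C :=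
  (mem_subfieldImage_iff B C _).2 ⟨z, hz, rfl⟩

/-- **The minimum distance does not decrease under the subfield image.** [folklore] -/
theorem minDist_le_minDist_subfieldImage [DecidableEq K] [DecidableEq L] (B : Module.Basis κ K L)
    (C : Submodule L (ι → L)) : minDist C ≤ minDist (subfieldImage B C) := by
  rw [le_minDist_iff]
  intro w hw hw0
  obtain ⟨z, hz, rfl⟩ := (mem_subfieldImage_iff B C w).1 hw
  have hz0 : z ≠ 0 := by
    rintro rfl
    exact hw0 (map_zero _)
  calc minDist C ≤ hammingNorm z := minDist_le_hammingNorm hz hz0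
    _ ≤ hammingNorm (expand B z) := by exact_mod_cast hammingNorm_le_hammingNorm_expand B z

/-! ### Duality: the trace-dual basis -/

section TraceDual

variable [FiniteDimensional K L] [Algebra.IsSeparable K L]

omit [FiniteDimensional K L] [Algebra.IsSeparable K L] [Fintype ι] in
/-- `Σ_t (B-coordinate t of a) · Tr(b β_t) = Tr(b a)` (expand `a` in the basis `B`). [folklore] -/
theorem sum_repr_mul_trace (B : Module.Basis κ K L) (a b : L) :
    ∑ t, B.repr a t * Algebra.trace K L (b * B t) = Algebra.trace K L (b * a) := by
  calc ∑ t, B.repr a t * Algebra.trace K L (b * B t)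
      = ∑ t, Algebra.trace K L (B.repr a t • (b * B t)) := by
        simp_rw [map_smul, smul_eq_mul]
    _ = Algebra.trace K L (∑ t, B.repr a t • (b * B t)) := by rw [map_sum]
    _ = Algebra.trace K L (b * ∑ t, B.repr a t • B t) := by
        simp_rw [Finset.mul_sum, mul_smul_comm]
    _ = Algebra.trace K L (b * a) := by rw [B.sum_repr]

/-- **The expansion turns the dot product into a trace**: for the basis `B` and its trace-dual
basis `B^∨ = B.traceDual` (Mathlib: `Tr(β^∨_s β_t) = δ_{st}`, coordinates
`(B^∨)`-coord`_t (x) = Tr(x β_t)`), `⟨expand B y, expand B^∨ z⟩_K = Tr_{L/K} ⟨y, z⟩_L`. [folklore] -/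
theorem expand_dotProduct_expand_traceDual [DecidableEq κ] (B : Module.Basis κ K L) (y z : ι → L) :
    expand B y ⬝ᵥ expand B.traceDual z = Algebra.trace K L (y ⬝ᵥ z) := by
  rw [dotProduct, dotProduct, Fintype.sum_prod_type, map_sum]
  refine Finset.sum_congr rfl fun j _ => ?_
  simp only [expand_apply, Module.Basis.traceDual_repr_apply, Algebra.traceForm_apply]
  rw [sum_repr_mul_trace, mul_comm]

/-- **The dual of the subfield image lies in the image of the dual under the trace-dual basis.**
If `w ∈ K^{ι × κ}` is orthogonal to `expand B (C)` then `w = expand B^∨ z` for a `z` orthogonal to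
`C`: writing `w = expand B^∨ z`, for `c ∈ C` and every `λ ∈ L` also `λc ∈ C`, so
`0 = ⟨expand B (λc), w⟩ = Tr(λ ⟨c, z⟩)`, whence `⟨c, z⟩ = 0` by nondegeneracy of the trace form.
[folklore] -/
theorem dualCode_subfieldImage_le [DecidableEq κ] (B : Module.Basis κ K L) (C : Submodule L (ι → L)) :
    dualCode (subfieldImage B C) ≤ subfieldImage B.traceDual (dualCode C) := by
  intro w hw
  rw [mem_dualCode_iff] at hw
  obtain ⟨z, rfl⟩ := expand_surjective B.traceDual w
  refine expand_mem_subfieldImage _ (mem_dualCode_iff.2 fun c hc => ?_)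
  refine (traceForm_nondegenerate K L).1 _ fun l => ?_
  rw [Algebra.traceForm_apply, mul_comm, ← smul_eq_mul, ← smul_dotProduct,
    ← expand_dotProduct_expand_traceDual B]
  exact hw _ (expand_mem_subfieldImage B (C.smul_mem l hc))

/-- The reverse inclusion: the image of the dual under the trace-dual basis is orthogonal to the
image. [folklore] -/
theorem subfieldImage_dualCode_le [DecidableEq κ] (B : Module.Basis κ K L) (C : Submodule L (ι → L)) :
    subfieldImage B.traceDual (dualCode C) ≤ dualCode (subfieldImage B C) := by
  intro w hw
  obtain ⟨z, hz, rfl⟩ := (mem_subfieldImage_iff _ _ w).1 hw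
  rw [mem_dualCode_iff]
  intro w' hw'
  obtain ⟨y, hy, rfl⟩ := (mem_subfieldImage_iff _ _ w').1 hw'
  rw [expand_dotProduct_expand_traceDual, mem_dualCode_iff.1 hz y hy, map_zero]

/-- **The dual of the subfield image is the image of the dual under the trace-dual basis.**
[folklore] -/
theorem dualCode_subfieldImage [DecidableEq κ] (B : Module.Basis κ K L) (C : Submodule L (ι → L)) :
    dualCode (subfieldImage B C) = subfieldImage B.traceDual (dualCode C) :=
  le_antisymm (dualCode_subfieldImage_le B C) (subfieldImage_dualCode_le B C)

/-- **The dual distance does not decrease under the subfield image**: every nonzero word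
orthogonal to the image of `C` is the expansion of a nonzero word orthogonal to `C`, which has at
most as many nonzero entries. With `minDist_le_minDist_subfieldImage`: a code over `𝔽_{2^m}` of
length `N` with distance `≥ δN` and dual distance `≥ δ'N` yields a binary code of length `mN` with
distance `≥ δN` and dual distance `≥ δ'N` (linear in the length for fixed `m`; this is how binary
codes with linear dual distance arise from algebraic-geometry codes over `𝔽₆₄`). [folklore] -/
theorem dualDist_le_dualDist_subfieldImage [DecidableEq K] [DecidableEq L] [DecidableEq κ]
    (B : Module.Basis κ K L) (C : Submodule L (ι → L)) :
    dualDist C ≤ dualDist (subfieldImage B C) := by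
  rw [le_dualDist_iff]
  intro w hw hw0
  have hmem : w ∈ dualCode (subfieldImage B C) := mem_dualCode_iff.2 hw
  obtain ⟨z, hz, rfl⟩ := (mem_subfieldImage_iff _ _ w).1 (dualCode_subfieldImage_le B C hmem)
  have hz0 : z ≠ 0 := by
    rintro rfl
    exact hw0 (map_zero _)
  calc dualDist C ≤ hammingNorm z := dualDist_le_hammingNorm (mem_dualCode_iff.1 hz) hz0
    _ ≤ hammingNorm (expand B.traceDual z) := by
        exact_mod_cast hammingNorm_le_hammingNorm_expand B.traceDual z

end TraceDual

/-! ### Reindexing coordinates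

To present a subfield image `≤ K^{ι × κ}` as a code of block length `|ι|·|κ|` on `Fin (|ι|·|κ|)`
(as in `Literature.Barriers.PneNP.DecodableDualDistanceCodes`), transport along an equivalence of
coordinate sets; weights, minimum distance, duals and dual distance are invariant. -/

section Reindex

variable {F : Type*} [Field F] {ι' : Type*} [Fintype ι']

omit [Fintype ι] [Fintype ι'] in
/-- Reindexing a word along `e : ι ≃ ι'` is Mathlib's `LinearEquiv.funCongrLeft F F e.symm`:
`LinearEquiv.funCongrLeft F F e.symm x i' = x (e.symm i')`. [folklore] -/
theorem funCongrLeft_symm_apply' (e : ι ≃ ι') (x : ι → F) (i' : ι') :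
    LinearEquiv.funCongrLeft F F e.symm x i' = x (e.symm i') := rfl

/-- The Hamming weight is invariant under reindexing. [folklore] -/
theorem hammingNorm_funCongrLeft [DecidableEq F] (e : ι ≃ ι') (x : ι → F) :
    hammingNorm (LinearEquiv.funCongrLeft F F e.symm x) = hammingNorm x := by
  unfold hammingNorm
  refine Finset.card_equiv e.symm fun i' => ?_
  simp [LinearEquiv.funCongrLeft_apply]

/-- The dot product is invariant under reindexing. [folklore] -/
theorem funCongrLeft_dotProduct_funCongrLeft (e : ι ≃ ι') (x y : ι → F) :
    LinearEquiv.funCongrLeft F F e.symm x ⬝ᵥ LinearEquiv.funCongrLeft F F e.symm y = x ⬝ᵥ y := by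
  simp only [dotProduct, LinearEquiv.funCongrLeft_apply]
  exact e.symm.sum_comp (fun i => x i * y i)

omit [Fintype ι] [Fintype ι'] in
/-- `e ∘ e⁻¹`: reindexing back and forth is the identity. [folklore] -/
theorem funCongrLeft_funCongrLeft_symm (e : ι ≃ ι') (x : ι → F) :
    LinearEquiv.funCongrLeft F F e (LinearEquiv.funCongrLeft F F e.symm x) = x := by
  rw [← LinearEquiv.funCongrLeft_symm, LinearEquiv.apply_symm_apply]

omit [Fintype ι] [Fintype ι'] in
/-- `e⁻¹ ∘ e`: reindexing forth and back is the identity. [folklore] -/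
theorem funCongrLeft_symm_funCongrLeft (e : ι ≃ ι') (y : ι' → F) :
    LinearEquiv.funCongrLeft F F e.symm (LinearEquiv.funCongrLeft F F e y) = y := by
  rw [← LinearEquiv.funCongrLeft_symm, LinearEquiv.symm_apply_apply]

/-- **Reindexing a code** along an equivalence of coordinate sets `e : ι ≃ ι'`. [folklore] -/
def reindex (e : ι ≃ ι') (C : Submodule F (ι → F)) : Submodule F (ι' → F) :=
  C.map (LinearEquiv.funCongrLeft F F e.symm).toLinearMap

omit [Fintype ι] [Fintype ι'] in
/-- Membership in the reindexed code: `y ∈ reindex e C ↔ y ∘ e ∈ C`. [folklore] -/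
theorem mem_reindex_iff (e : ι ≃ ι') (C : Submodule F (ι → F)) (y : ι' → F) :
    y ∈ reindex e C ↔ (LinearEquiv.funCongrLeft F F e y) ∈ C := by
  constructor
  · rintro ⟨x, hx, rfl⟩
    rw [LinearEquiv.coe_coe, funCongrLeft_funCongrLeft_symm]
    exact hx
  · intro hy
    exact ⟨_, hy, by rw [LinearEquiv.coe_coe, funCongrLeft_symm_funCongrLeft]⟩

/-- **The minimum distance is invariant under reindexing.** [folklore] -/
theorem minDist_reindex [DecidableEq F] (e : ι ≃ ι') (C : Submodule F (ι → F)) :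
    minDist (reindex e C) = minDist C := by
  refine le_antisymm ?_ ?_
  · rw [le_minDist_iff]
    intro x hx hx0
    have hmem : LinearEquiv.funCongrLeft F F e.symm x ∈ reindex e C := ⟨x, hx, rfl⟩
    have h0 : LinearEquiv.funCongrLeft F F e.symm x ≠ 0 :=
      (LinearEquiv.funCongrLeft F F e.symm).map_ne_zero_iff.2 hx0
    calc minDist (reindex e C) ≤ hammingNorm (LinearEquiv.funCongrLeft F F e.symm x) :=
          minDist_le_hammingNorm hmem h0
      _ = hammingNorm x := by rw [hammingNorm_funCongrLeft]
  · rw [le_minDist_iff]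
    rintro _ ⟨x, hx, rfl⟩ h0
    have hx0 : x ≠ 0 := by
      rintro rfl
      exact h0 (map_zero _)
    calc minDist C ≤ hammingNorm x := minDist_le_hammingNorm hx hx0
      _ = _ := by rw [LinearEquiv.coe_coe, hammingNorm_funCongrLeft]

/-- Reindexing one factor of a dot product is undone by reindexing the other one back.
[folklore] -/
theorem funCongrLeft_symm_dotProduct (e : ι ≃ ι') (c : ι → F) (y : ι' → F) :
    LinearEquiv.funCongrLeft F F e.symm c ⬝ᵥ y = c ⬝ᵥ LinearEquiv.funCongrLeft F F e y := by
  have h := funCongrLeft_dotProduct_funCongrLeft e c (LinearEquiv.funCongrLeft F F e y)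
  rwa [funCongrLeft_symm_funCongrLeft] at h

/-- **The dual code commutes with reindexing.** [folklore] -/
theorem dualCode_reindex (e : ι ≃ ι') (C : Submodule F (ι → F)) :
    dualCode (reindex e C) = reindex e (dualCode C) := by
  ext y
  rw [mem_dualCode_iff, mem_reindex_iff, mem_dualCode_iff]
  constructor
  · intro h c hc
    rw [← funCongrLeft_symm_dotProduct]
    exact h _ ((mem_reindex_iff e C _).2 (by rwa [funCongrLeft_funCongrLeft_symm]))
  · intro h c' hc'
    rw [mem_reindex_iff] at hc'
    have h' := h _ hc'
    rwa [← funCongrLeft_symm_dotProduct, funCongrLeft_symm_funCongrLeft] at h'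

/-- **The dual distance is invariant under reindexing.** [folklore] -/
theorem dualDist_reindex [DecidableEq F] (e : ι ≃ ι') (C : Submodule F (ι → F)) :
    dualDist (reindex e C) = dualDist C := by
  rw [dualDist, dualCode_reindex, minDist_reindex, dualDist]

end Reindex

end Literature.InformationTheory.Coding

end
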